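import Mathlib
import HarnessLib
import Literature.Analysis.FluidPDE.SelfSimilar
import Literature.Analysis.FluidPDE.LocalTypeI
import Literature.Analysis.FluidPDE.VectorCalculus
import Literature.Analysis.FluidPDE.ClassicalSolution
import Literature.Analysis.FluidPDE.TypeIAncientMild
import Literature.Analysis.UnboundedOperators.HeatKernel
import Summits.NavierStokesRegularity.NavierStokesRegularity.Theorems.LocalSineTubeDoorProfileAlignedWindowRigidityAncient
import Summits.NavierStokesRegularity.NavierStokesRegularity.Theorems.PoloidalWindowDoorPoloidalWindowRigidityWindow
import Summits.NavierStokesRegularity.NavierStokesRegularity.Theorems.PoloidalWindowDoorPoloidalWindowRigidityFlat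
import Summits.NavierStokesRegularity.NavierStokesRegularity.Theorems.PoloidalWindowDoorPoloidalWindowRigidityOneSlice
import Summits.NavierStokesRegularity.NavierStokesRegularity.Theorems.PoloidalWindowDoorPoloidalWindowRigidityClassRate
import Summits.NavierStokesRegularity.NavierStokesRegularity.Theorems.PoloidalWindowDoorPoloidalWindowRigidityScrewAssembly
import Summits.NavierStokesRegularity.NavierStokesRegularity.Theorems.PoloidalWindowDoorPoloidalWindowRigidityDecayingSlopeLiouville

/-!
# Route `PoloidalWindowDoor`, crux `PoloidalWindowRigidity` (K2, stmt-NavierStokesRegularity-19708) — the stratum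
# «VERTICAL SOURCE GAUGE»: a spatially constant vertical pressure gradient forces triviality

Cell ns-regularity-ideate, seat ns-poloidal-K2-p3 (stub-worker; support theorem `--supports` the crux, `--as helper`).
This is the twin, for the vertical velocity `v₃ = v·e₃`, of the K2 lead's source-gauge stratum for the Clebsch stream
function (`…SourceGauge.eq_zero_of_streamSourceGauge`, nsreg-p7, CENSUS-K2G §12 Cor. A): the two scalars `(ψ, v₃)`
of the poloidal leaf map are transported–diffused with sources `(T, −∂₃p)`, and the lead's new-mechanism search (p7 g4
plan (a)) asks whether the PAIR admits a gauge with time-only sources.  The single-scalar extreme on the `v₃` side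
costs nothing beyond the tree:

* for a profile of the route's Type-I class, `θ(t, y) = ⟪v(t,y), e₃⟫` is jointly `C²` on the open slab, satisfies
  `∂ₜθ + (v·∇)θ − Δθ = ⟪∂ₜv + (v·∇)v − Δv, e₃⟫` (`= −∂₃p` on every window with a classical pressure), and has decaying
  slope `|θ(t,x) − θ(t,0)| ≤ (C₁/(−t))‖x‖` (gradient rate of nsreg-p7's `…ClassRate.exists_fderiv_rate_of_class` + the
  mean value inequality);
* so IF the vertical component of `∂ₜv + (v·∇)v − Δv` is spatially constant on every slice (hypothesis `hsrc`, stated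
  intrinsically — no pressure is named), the lead's L4 `…DecayingSlopeLiouville.stub_decayingSlopeLiouville` (p457547)
  makes `v₃(t, ·)` constant, hence `v·e₃` is flat in every horizontal direction, and nsreg-p6's flat stratum
  `…OneSlice.eq_zero_of_flat_slice` ends (this last step uses poloidality): `eq_zero_of_verticalSourceGauge`.

So the residue may assume «on some slice the vertical pressure gradient ∂₃p(t,·) is NOT spatially constant».

WHAT THIS IS NOT: not a claim about Navier–Stokes regularity and not the open residue — one more settled stratum of a
door route's Type-I Liouville problem (bears_on LADDER-NS N0, rung N0-LocalTubeDoorPoloidal).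
-/

noncomputable section

-- the summit and its single sub-problem share the name (CONVENTIONS §1), as in every Theorems file
set_option linter.dupNamespace false

namespace Summit.NavierStokesRegularity.NavierStokesRegularity.Theorems.PoloidalWindowDoorPoloidalWindowRigidityVerticalSourceGauge

open MeasureTheory Set Function Filter Topology TopologicalSpace Metric InnerProductSpace
open scoped RealInnerProductSpace InnerProductSpace Laplacian ContDiff
open Literature.Analysis Literature.Analysis.FluidPDE
open Summit.NavierStokesRegularity.NavierStokesRegularity.Theorems.LocalSineTubeDoorProfileAlignedWindowRigidityAncient
open Summit.NavierStokesRegularity.NavierStokesRegularity.Theorems.PoloidalWindowDoorPoloidalWindowRigidityWindow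
open Summit.NavierStokesRegularity.NavierStokesRegularity.Theorems.PoloidalWindowDoorPoloidalWindowRigidityFlat
open Summit.NavierStokesRegularity.NavierStokesRegularity.Theorems.PoloidalWindowDoorPoloidalWindowRigidityOneSlice
open Summit.NavierStokesRegularity.NavierStokesRegularity.Theorems.PoloidalWindowDoorPoloidalWindowRigidityClassRate
open Summit.NavierStokesRegularity.NavierStokesRegularity.Theorems.PoloidalWindowDoorPoloidalWindowRigidityScrewAssembly
open Summit.NavierStokesRegularity.NavierStokesRegularity.Theorems.PoloidalWindowDoorPoloidalWindowRigidityDecayingSlopeLiouville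

variable {C : ℝ} {v : ℝ → EuclideanSpace ℝ (Fin 3) → EuclideanSpace ℝ (Fin 3)}

/-! ### The vertical velocity `θ = v·e₃` of a profile of the class -/

/-- **`θ(t,y) = ⟪v(t,y), e₃⟫` is jointly `C²` on the open slab** (the class is jointly `C^∞` there). -/
theorem contDiffOn_vertical (hrate : HasTypeITimeDecay C v)
    (hcont : ContinuousOn (uncurry v) (Iio (0 : ℝ) ×ˢ univ))
    (hmild : ∀ s t : ℝ, s < t → t < 0 → ∀ x,
      v t x = UnboundedOperators.heatExtension (v s) (t - s) x - oseenDuhamel 1 s v v t x)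
    (hdiv : ∀ t < 0, VectorCalculus.IsDivFree (v t)) :
    ContDiffOn ℝ 2 (uncurry fun (t : ℝ) (y : EuclideanSpace ℝ (Fin 3)) =>
      ⟪v t y, (EuclideanSpace.single 2 (1 : ℝ) : EuclideanSpace ℝ (Fin 3))⟫_ℝ) (Iio (0 : ℝ) ×ˢ univ) := by
  have hA : IsTypeIAncientMild C v := isTypeIAncientMild_of_class hrate hcont hmild hdiv
  have h1 : ContDiffOn ℝ 2 (uncurry v) (Iio (0 : ℝ) ×ˢ univ) := contDiffOn_infty.1 hA.contDiffOn 2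
  exact h1.inner ℝ contDiffOn_const

/-- **The transported–diffused equation of `θ = v·e₃` with the INTRINSIC vertical source**: for every `t < 0`, `x`,
`∂ₜθ + (v·∇)θ − Δθ = ⟪∂ₜv + (v·∇)v − Δv, e₃⟫(t, x)` — the `e₃`-component of the material operator applied to `v`
(on every window with a classical pressure this is `−∂₃p(t,x)`). -/
theorem vertical_equation (hrate : HasTypeITimeDecay C v)
    (hcont : ContinuousOn (uncurry v) (Iio (0 : ℝ) ×ˢ univ))
    (hmild : ∀ s t : ℝ, s < t → t < 0 → ∀ x,
      v t x = UnboundedOperators.heatExtension (v s) (t - s) x - oseenDuhamel 1 s v v t x)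
    (hdiv : ∀ t < 0, VectorCalculus.IsDivFree (v t)) {t : ℝ} (ht : t < 0) (x : EuclideanSpace ℝ (Fin 3)) :
    deriv (fun τ => ⟪v τ x, (EuclideanSpace.single 2 (1 : ℝ) : EuclideanSpace ℝ (Fin 3))⟫_ℝ) t
        + fderiv ℝ (fun y => ⟪v t y, (EuclideanSpace.single 2 (1 : ℝ) : EuclideanSpace ℝ (Fin 3))⟫_ℝ) x (v t x)
        - (Δ (fun y => ⟪v t y, (EuclideanSpace.single 2 (1 : ℝ) : EuclideanSpace ℝ (Fin 3))⟫_ℝ)) x =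
      ⟪timeDerivWithin (Iio 0) v t x + convect (v t) (v t) x - (Δ (v t)) x,
        (EuclideanSpace.single 2 (1 : ℝ) : EuclideanSpace ℝ (Fin 3))⟫_ℝ := by
  have hA : IsTypeIAncientMild C v := isTypeIAncientMild_of_class hrate hcont hmild hdiv
  have hsm : IsSmoothSpaceTimeOn (Iio (0 : ℝ)) v := hA.contDiffOn
  have hS : UniqueDiffOn ℝ (Iio (0 : ℝ)) := isOpen_Iio.uniqueDiffOn
  set e : EuclideanSpace ℝ (Fin 3) := EuclideanSpace.single 2 (1 : ℝ) with he
  have hv2 : ContDiff ℝ 2 (v t) := contDiff_infty.1 (hA.contDiff_slice ht) 2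
  have hvd : DifferentiableAt ℝ (v t) x := (hv2.differentiable two_ne_zero) x
  -- (T) the time derivative: `S = Iio 0` is open, so `derivWithin = deriv`
  have hT : deriv (fun τ => ⟪v τ x, e⟫_ℝ) t = ⟪timeDerivWithin (Iio 0) v t x, e⟫_ℝ := by
    have hd : HasDerivWithinAt (fun τ => v τ x) (timeDerivWithin (Iio 0) v t x) (Iio 0) t := by
      rw [timeDerivWithin_apply]
      exact (hsm.differentiableWithinAt_time ht x).hasDerivWithinAt
    have hd' : HasDerivAt (fun τ => v τ x) (timeDerivWithin (Iio 0) v t x) t :=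
      hd.hasDerivAt (Iio_mem_nhds ht)
    have h1 := hd'.inner ℝ (hasDerivAt_const t e)
    simp only [inner_zero_right, zero_add] at h1
    exact h1.deriv
  -- (X) the convective derivative
  have hX : fderiv ℝ (fun y => ⟪v t y, e⟫_ℝ) x (v t x) = ⟪convect (v t) (v t) x, e⟫_ℝ := by
    rw [fderiv_inner_apply ℝ hvd (differentiableAt_const e) (v t x), fderiv_fun_const]
    simp [convect]
  -- (L) the Laplacian
  have hL : (Δ (fun y => ⟪v t y, e⟫_ℝ)) x = ⟪(Δ (v t)) x, e⟫_ℝ := by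
    have hfun : (fun y => ⟪v t y, e⟫_ℝ) = (innerSL ℝ e : EuclideanSpace ℝ (Fin 3) →L[ℝ] ℝ) ∘ v t := by
      funext y; simp only [Function.comp_apply, innerSL_apply_apply, real_inner_comm]
    rw [hfun, hv2.contDiffAt.laplacian_CLM_comp_left, Function.comp_apply, innerSL_apply_apply, real_inner_comm]
  rw [hT, hX, hL, inner_sub_left, inner_add_left]

/-- **Decaying slope of `θ = v·e₃`**: `|θ(t,x) − θ(t,0)| ≤ (C₁/(−t))‖x − 0‖` with the gradient rate `C₁` of the
class (nsreg-p7 `exists_fderiv_rate_of_class` + the mean value inequality). -/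
theorem vertical_slope (hrate : HasTypeITimeDecay C v)
    (hcont : ContinuousOn (uncurry v) (Iio (0 : ℝ) ×ˢ univ))
    (hmild : ∀ s t : ℝ, s < t → t < 0 → ∀ x,
      v t x = UnboundedOperators.heatExtension (v s) (t - s) x - oseenDuhamel 1 s v v t x)
    {C₁ : ℝ} (hC₁ : ∀ t < 0, ∀ y, ‖fderiv ℝ (v t) y‖ ≤ C₁ / (-t)) {t : ℝ} (ht : t < 0)
    (x : EuclideanSpace ℝ (Fin 3)) :
    |⟪v t x, (EuclideanSpace.single 2 (1 : ℝ) : EuclideanSpace ℝ (Fin 3))⟫_ℝ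
        - ⟪v t 0, (EuclideanSpace.single 2 (1 : ℝ) : EuclideanSpace ℝ (Fin 3))⟫_ℝ| ≤ C₁ / (-t) * ‖x - 0‖ := by
  have hbdd := bdd_of_hasTypeITimeDecay hrate
  have hC1 : ContDiff ℝ 1 (v t) := (analyticOnNhd_slice hcont hbdd hmild ht).contDiff
  have hd : Differentiable ℝ (v t) := hC1.differentiable one_ne_zero
  have hmv : ‖v t x - v t 0‖ ≤ C₁ / (-t) * ‖x - 0‖ :=
    (convex_univ).norm_image_sub_le_of_norm_fderiv_le (fun y _ => hd y) (fun y _ => hC₁ t ht y)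
      (mem_univ 0) (mem_univ x)
  have he : ‖(EuclideanSpace.single 2 (1 : ℝ) : EuclideanSpace ℝ (Fin 3))‖ = 1 := by
    rw [EuclideanSpace.single, PiLp.norm_single, norm_one]
  rw [← inner_sub_left]
  calc |⟪v t x - v t 0, (EuclideanSpace.single 2 (1 : ℝ) : EuclideanSpace ℝ (Fin 3))⟫_ℝ|
      ≤ ‖v t x - v t 0‖ * ‖(EuclideanSpace.single 2 (1 : ℝ) : EuclideanSpace ℝ (Fin 3))‖ :=
        abs_real_inner_le_norm _ _
    _ = ‖v t x - v t 0‖ := by rw [he, mul_one]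
    _ ≤ C₁ / (-t) * ‖x - 0‖ := hmv

/-! ### The stratum -/

/-- **VERTICAL SOURCE GAUGE ⇒ trivial.**  A profile of the route's Type-I class, poloidal along `e₃`, for which the
vertical component of `∂ₜv + (v·∇)v − Δv` (i.e. `−∂₃p` on every window) is SPATIALLY CONSTANT on every slice, vanishes
identically: `θ = v·e₃` satisfies the lead's L4 `stub_decayingSlopeLiouville` (joint `C²`, time-only source, decaying
slope `C₁/(−t)`), so `v₃(t,·)` is constant; then `v·e₃` is flat along `e₀` and nsreg-p6's `eq_zero_of_flat_slice` ends. -/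
theorem eq_zero_of_verticalSourceGauge (hrate : HasTypeITimeDecay C v)
    (hcont : ContinuousOn (uncurry v) (Iio (0 : ℝ) ×ˢ univ))
    (hmild : ∀ s t : ℝ, s < t → t < 0 → ∀ x,
      v t x = UnboundedOperators.heatExtension (v s) (t - s) x - oseenDuhamel 1 s v v t x)
    (hdiv : ∀ t < 0, VectorCalculus.IsDivFree (v t))
    (hpol : ∀ s < 0, ∀ y, ⟪curl (v s) y, EuclideanSpace.single 2 1⟫_ℝ = 0)
    (hsrc : ∀ t < 0, ∀ x,
      ⟪timeDerivWithin (Iio 0) v t x + convect (v t) (v t) x - (Δ (v t)) x,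
          (EuclideanSpace.single 2 (1 : ℝ) : EuclideanSpace ℝ (Fin 3))⟫_ℝ =
        ⟪timeDerivWithin (Iio 0) v t 0 + convect (v t) (v t) 0 - (Δ (v t)) 0,
          (EuclideanSpace.single 2 (1 : ℝ) : EuclideanSpace ℝ (Fin 3))⟫_ℝ) :
    ∀ t < 0, ∀ x, v t x = 0 := by
  obtain ⟨C₁, hC₁⟩ := exists_fderiv_rate_of_class hrate hcont hmild
  have hbdd := bdd_of_hasTypeITimeDecay hrate
  -- ## L4 for `θ = v·e₃`
  have hconst := stub_decayingSlopeLiouville C v hrate hcont hmild hdiv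
    (fun t y => ⟪v t y, (EuclideanSpace.single 2 (1 : ℝ) : EuclideanSpace ℝ (Fin 3))⟫_ℝ)
    (fun t => ⟪timeDerivWithin (Iio 0) v t 0 + convect (v t) (v t) 0 - (Δ (v t)) 0,
      (EuclideanSpace.single 2 (1 : ℝ) : EuclideanSpace ℝ (Fin 3))⟫_ℝ)
    0 (fun t => C₁ / (-t))
    (contDiffOn_vertical hrate hcont hmild hdiv)
    (fun t ht x => by rw [vertical_equation hrate hcont hmild hdiv ht x, hsrc t ht x])
    (fun t ht x => vertical_slope hrate hcont hmild hC₁ ht x)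
    (continuousOn_rate C₁) (tendsto_rate_mul_sqrt C₁)
  -- ## hence `v·e₃` is flat along `e₀` on the slice `−1`
  have hs : (-1 : ℝ) < 0 := by norm_num
  have hflat : ∀ y, ⟪fderiv ℝ (v (-1)) y (EuclideanSpace.single 0 1), EuclideanSpace.single 2 1⟫_ℝ = 0 := by
    intro y
    have hC1 : ContDiff ℝ 1 (v (-1)) := (analyticOnNhd_slice hcont hbdd hmild hs).contDiff
    have hd : DifferentiableAt ℝ (v (-1)) y := (hC1.differentiable one_ne_zero) y
    have hfun : (fun z => ⟪v (-1) z, (EuclideanSpace.single 2 (1 : ℝ) : EuclideanSpace ℝ (Fin 3))⟫_ℝ) =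
        fun _ => ⟪v (-1) 0, (EuclideanSpace.single 2 (1 : ℝ) : EuclideanSpace ℝ (Fin 3))⟫_ℝ :=
      funext fun z => hconst (-1) hs z
    have h1 : fderiv ℝ (fun z => ⟪v (-1) z, (EuclideanSpace.single 2 (1 : ℝ) : EuclideanSpace ℝ (Fin 3))⟫_ℝ) y
        (EuclideanSpace.single 0 1) = 0 := by
      rw [hfun, fderiv_fun_const]; rfl
    rw [fderiv_inner_apply ℝ hd (differentiableAt_const _) (EuclideanSpace.single 0 1), fderiv_fun_const] at h1
    simpa using h1
  have he0 : (EuclideanSpace.single 0 1 : EuclideanSpace ℝ (Fin 3)) ≠ 0 := fun h0 => by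
    simpa using congrArg (fun w : EuclideanSpace ℝ (Fin 3) => w 0) h0
  have he03 : ⟪(EuclideanSpace.single 0 1 : EuclideanSpace ℝ (Fin 3)), EuclideanSpace.single 2 1⟫_ℝ = 0 := by
    simp [EuclideanSpace.inner_single_left]
  exact eq_zero_of_flat_slice hrate hcont hmild hdiv hs (hpol (-1) hs) he0 he03 hflat

/-- **Vertical source gauge ⇒ not backward-singular.** -/
theorem nonflatLiouville_of_verticalSourceGauge (hrate : HasTypeITimeDecay C v)
    (hcont : ContinuousOn (uncurry v) (Iio (0 : ℝ) ×ˢ univ))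
    (hmild : ∀ s t : ℝ, s < t → t < 0 → ∀ x,
      v t x = UnboundedOperators.heatExtension (v s) (t - s) x - oseenDuhamel 1 s v v t x)
    (hdiv : ∀ t < 0, VectorCalculus.IsDivFree (v t))
    (hpol : ∀ s < 0, ∀ y, ⟪curl (v s) y, EuclideanSpace.single 2 1⟫_ℝ = 0)
    (hsrc : ∀ t < 0, ∀ x,
      ⟪timeDerivWithin (Iio 0) v t x + convect (v t) (v t) x - (Δ (v t)) x,
          (EuclideanSpace.single 2 (1 : ℝ) : EuclideanSpace ℝ (Fin 3))⟫_ℝ =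
        ⟪timeDerivWithin (Iio 0) v t 0 + convect (v t) (v t) 0 - (Δ (v t)) 0,
          (EuclideanSpace.single 2 (1 : ℝ) : EuclideanSpace ℝ (Fin 3))⟫_ℝ) :
    ¬ IsBackwardSingularPoint v 0 :=
  not_backwardSingular_of_zero (eq_zero_of_verticalSourceGauge hrate hcont hmild hdiv hpol hsrc)

end Summit.NavierStokesRegularity.NavierStokesRegularity.Theorems.PoloidalWindowDoorPoloidalWindowRigidityVerticalSourceGauge

end
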